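import Mathlib
import HarnessLib
import Summits.Ventures.LatticeQCDFlow.Exactness.SU2MemberGaugeCovariance
import Summits.Ventures.LatticeQCDFlow.Exactness.SU2MaskedKickScheduleErgodic
import Summits.Ventures.LatticeQCDFlow.Exactness.SU2WilsonFlowLOAcceptanceLattice

/-!
# On the row's acceptance configuration — 4⁴ `SU(2)`, parity masks, Lüscher's schedule — the LO member is gauge covariant and FT-HMC through it (single-step kernel) is uniformly ergodic

HONEST FRAMING: exact (Metropolis-corrected) sampling algorithms for lattice gauge theory;
figures of merit are autocorrelation/cost numbers at stated couplings and volumes; no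
continuum-physics claim.

Venture `LatticeQCDFlow` (cell pub-lqcd), topic `Exactness`; FANOUT row 14 (`eng-flowhmc`; the
row's acceptance test runs the LO Wilson-flow member inside HMC on the 4⁴ `SU(2)` lattice).  NEW
WORK of the cell; nothing is cited as a fact; no number.  GEN-7's
`SU2WilsonFlowLOAcceptanceLattice.lean` packaged the member at `d = L = 4` (parity colouring
`χ : Site 4 4 → ZMod 2`, schedule = `nsweeps` sweeps over the 4 directions × 2 parities, `8·nsweeps`
certified sub-steps, refusal rule `6|ε| < 1`) and proved exactness / reversibility / Creutz.  The
GEN-9 member-level theorems specialise to the same package: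

* **`su2_fthmc_acceptanceLattice_gauge`** — the member is `IsGaugeEquivariant` and its running
  log-det `IsGaugeInvariant` (`su2WilsonFlowLO_member_gauge`); hence `S∘F − log J` is a class
  function for every gauge-invariant `S` (`isGaugeInvariant_ftAction`);
* **`su2_fthmc_acceptanceLattice_uniformlyErgodic`** — row 9's reported single-step leapfrog
  FT-HMC kernel through the member converges to `π_S` geometrically in total variation from every
  initial law, for every measurable bounded action and momentum increment, `ε', κ' > 0`
  (`su2WilsonFlowLO_member_fthmc_uniformlyErgodic`, `κ₀ = 6|ε|`).

NOT CLAIMED: the engine's multi-step trajectories inside the ergodic statement; any usable `δ`;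
`β = 2.2`-specific anything; any number.
-/

noncomputable section

namespace Summit.Ventures.LatticeQCDFlow.Exactness

open Real Set MeasureTheory Measure InnerProductGeometry ProbabilityTheory ProbabilityTheory.Kernel
open Literature.MathematicalPhysics.QuantumFieldTheory
open scoped ENNReal Matrix

/-- **The LO member on the 4⁴ `SU(2)` lattice (parity masks, Lüscher schedule, `6|ε| < 1`) is gauge
equivariant with a gauge-invariant running log-det.** -/
theorem su2_fthmc_acceptanceLattice_gauge {ε : ℝ} (hε : |ε| * 6 < 1) (nsweeps : ℕ) :
    ∃ χ : Site 4 4 → ZMod 2, (∀ (x : Site 4 4) (i : Fin 4), χ (x.shift i) ≠ χ x) ∧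
    ∃ layers : List ((GaugeConfig 4 4 (Matrix.specialUnitaryGroup (Fin 2) ℂ) ≃ᵐ GaugeConfig 4 4 (Matrix.specialUnitaryGroup (Fin 2) ℂ)) × (GaugeConfig 4 4 (Matrix.specialUnitaryGroup (Fin 2) ℂ) → ℝ)),
      layers.map (fun Ly => ((Ly.1 : GaugeConfig 4 4 (Matrix.specialUnitaryGroup (Fin 2) ℂ) → GaugeConfig 4 4 (Matrix.specialUnitaryGroup (Fin 2) ℂ)), Ly.2)) =
        ((List.replicate nsweeps ((List.finRange 4).flatMap fun μ : Fin 4 => [(μ, (0 : ZMod 2)), (μ, 1)])).flatten).map (fun s =>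
        ((fun (V : GaugeConfig 4 4 (Matrix.specialUnitaryGroup (Fin 2) ℂ)) (e : Edge 4 4) =>
        if e.2 = s.1 ∧ χ e.1 = s.2 then
          gaussUnit (geodesicKick ε (∑ ν ∈ Finset.univ.erase e.2,
            (vecQuat (((V (Site.shift e.1 e.2, ν) * (V (Site.shift e.1 ν, e.2))⁻¹ * (V (e.1, ν))⁻¹)⁻¹ : (Matrix.specialUnitaryGroup (Fin 2) ℂ)) : Matrix (Fin 2) (Fin 2) ℂ) +
              vecQuat ((((V (Site.shift (e.1 - Pi.single ν 1) e.2, ν))⁻¹ * (V (e.1 - Pi.single ν 1, e.2))⁻¹ *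
                V (e.1 - Pi.single ν 1, ν))⁻¹ : (Matrix.specialUnitaryGroup (Fin 2) ℂ)) : Matrix (Fin 2) (Fin 2) ℂ)))
            (vecQuat ((V e : (Matrix.specialUnitaryGroup (Fin 2) ℂ)) : Matrix (Fin 2) (Fin 2) ℂ)))
        else V e),
         fun V : GaugeConfig 4 4 (Matrix.specialUnitaryGroup (Fin 2) ℂ) => ∏ a : {e : Edge 4 4 // e.2 = s.1 ∧ χ e.1 = s.2},
          (if Real.sin (angle (∑ ν ∈ Finset.univ.erase a.1.2,
            (vecQuat (((V (Site.shift a.1.1 a.1.2, ν) * (V (Site.shift a.1.1 ν, a.1.2))⁻¹ * (V (a.1.1, ν))⁻¹)⁻¹ : (Matrix.specialUnitaryGroup (Fin 2) ℂ)) : Matrix (Fin 2) (Fin 2) ℂ) +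
              vecQuat ((((V (Site.shift (a.1.1 - Pi.single ν 1) a.1.2, ν))⁻¹ * (V (a.1.1 - Pi.single ν 1, a.1.2))⁻¹ *
                V (a.1.1 - Pi.single ν 1, ν))⁻¹ : (Matrix.specialUnitaryGroup (Fin 2) ℂ)) : Matrix (Fin 2) (Fin 2) ℂ))) (vecQuat ((V a.1 : (Matrix.specialUnitaryGroup (Fin 2) ℂ)) : Matrix (Fin 2) (Fin 2) ℂ))) = 0 then
            (1 - ε * ‖(∑ ν ∈ Finset.univ.erase a.1.2,
            (vecQuat (((V (Site.shift a.1.1 a.1.2, ν) * (V (Site.shift a.1.1 ν, a.1.2))⁻¹ * (V (a.1.1, ν))⁻¹)⁻¹ : (Matrix.specialUnitaryGroup (Fin 2) ℂ)) : Matrix (Fin 2) (Fin 2) ℂ) +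
              vecQuat ((((V (Site.shift (a.1.1 - Pi.single ν 1) a.1.2, ν))⁻¹ * (V (a.1.1 - Pi.single ν 1, a.1.2))⁻¹ *
                V (a.1.1 - Pi.single ν 1, ν))⁻¹ : (Matrix.specialUnitaryGroup (Fin 2) ℂ)) : Matrix (Fin 2) (Fin 2) ℂ)))‖ * Real.cos (angle (∑ ν ∈ Finset.univ.erase a.1.2,
            (vecQuat (((V (Site.shift a.1.1 a.1.2, ν) * (V (Site.shift a.1.1 ν, a.1.2))⁻¹ * (V (a.1.1, ν))⁻¹)⁻¹ : (Matrix.specialUnitaryGroup (Fin 2) ℂ)) : Matrix (Fin 2) (Fin 2) ℂ) +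
              vecQuat ((((V (Site.shift (a.1.1 - Pi.single ν 1) a.1.2, ν))⁻¹ * (V (a.1.1 - Pi.single ν 1, a.1.2))⁻¹ *
                V (a.1.1 - Pi.single ν 1, ν))⁻¹ : (Matrix.specialUnitaryGroup (Fin 2) ℂ)) : Matrix (Fin 2) (Fin 2) ℂ))) (vecQuat ((V a.1 : (Matrix.specialUnitaryGroup (Fin 2) ℂ)) : Matrix (Fin 2) (Fin 2) ℂ)))) ^ 3
          else kickJac (ε * ‖(∑ ν ∈ Finset.univ.erase a.1.2,
            (vecQuat (((V (Site.shift a.1.1 a.1.2, ν) * (V (Site.shift a.1.1 ν, a.1.2))⁻¹ * (V (a.1.1, ν))⁻¹)⁻¹ : (Matrix.specialUnitaryGroup (Fin 2) ℂ)) : Matrix (Fin 2) (Fin 2) ℂ) +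
              vecQuat ((((V (Site.shift (a.1.1 - Pi.single ν 1) a.1.2, ν))⁻¹ * (V (a.1.1 - Pi.single ν 1, a.1.2))⁻¹ *
                V (a.1.1 - Pi.single ν 1, ν))⁻¹ : (Matrix.specialUnitaryGroup (Fin 2) ℂ)) : Matrix (Fin 2) (Fin 2) ℂ)))‖) 2 (angle (∑ ν ∈ Finset.univ.erase a.1.2,
            (vecQuat (((V (Site.shift a.1.1 a.1.2, ν) * (V (Site.shift a.1.1 ν, a.1.2))⁻¹ * (V (a.1.1, ν))⁻¹)⁻¹ : (Matrix.specialUnitaryGroup (Fin 2) ℂ)) : Matrix (Fin 2) (Fin 2) ℂ) +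
              vecQuat ((((V (Site.shift (a.1.1 - Pi.single ν 1) a.1.2, ν))⁻¹ * (V (a.1.1 - Pi.single ν 1, a.1.2))⁻¹ *
                V (a.1.1 - Pi.single ν 1, ν))⁻¹ : (Matrix.specialUnitaryGroup (Fin 2) ℂ)) : Matrix (Fin 2) (Fin 2) ℂ))) (vecQuat ((V a.1 : (Matrix.specialUnitaryGroup (Fin 2) ℂ)) : Matrix (Fin 2) (Fin 2) ℂ)))))) ∧
      layers.length = 8 * nsweeps ∧
      IsGaugeEquivariant (⇑(layers.foldr (fun Ly (G : GaugeConfig 4 4 (Matrix.specialUnitaryGroup (Fin 2) ℂ) ≃ᵐ GaugeConfig 4 4 (Matrix.specialUnitaryGroup (Fin 2) ℂ)) => Ly.1.trans G)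
              (MeasurableEquiv.refl (GaugeConfig 4 4 (Matrix.specialUnitaryGroup (Fin 2) ℂ))))) ∧
      IsGaugeInvariant (layers.foldr (fun Ly K => fun V => Ly.2 V * K (Ly.1 V)) (fun _ => (1 : ℝ))) := by
  obtain ⟨χ, hχ⟩ := exists_parityMask (d := 4) (L := 4) (by decide)
  have hε' : |ε| * (2 * ((4 - 1 : ℕ) : ℝ)) < 1 := by norm_num; linarith
  obtain ⟨layers, hmap, -, -, -⟩ := exists_layers_su2WilsonFlowLO χ hχ hε'
    ((List.replicate nsweeps ((List.finRange 4).flatMap fun μ : Fin 4 => [(μ, (0 : ZMod 2)), (μ, 1)])).flatten)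
  refine ⟨χ, hχ, layers, hmap, ?_, ?_⟩
  · have h := congrArg List.length hmap
    rw [List.length_map, List.length_map, length_luscherSchedule_four] at h
    exact h
  · exact su2WilsonFlowLO_member_gauge χ ε _ layers hmap

/-- **FT-HMC (row 9's single-step leapfrog kernel) through the LO member on the 4⁴ `SU(2)` lattice
is uniformly ergodic**: for some `δ ∈ (0, 1]`, `|μ₀ K̃ᵗ(A) − π_S(A)| ≤ (1 − δ)ᵗ` for every initial
law, every `t`, every `A` — any measurable `|S| ≤ s`, `‖g‖ ≤ b`, `ε', κ' > 0`. -/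
theorem su2_fthmc_acceptanceLattice_uniformlyErgodic {ε : ℝ} (hε : |ε| * 6 < 1) (nsweeps : ℕ)
    {ε' κ' : ℝ} (hε' : 0 < ε') (hκ' : 0 < κ')
    {g : GaugeConfig 4 4 (Matrix.specialUnitaryGroup (Fin 2) ℂ) → Edge 4 4 → EuclideanSpace ℝ (Fin 3)} (hg : Measurable g) {b' : ℝ} (hb0 : 0 ≤ b')
    (hb : ∀ u l, ‖g u l‖ ≤ b') {S : GaugeConfig 4 4 (Matrix.specialUnitaryGroup (Fin 2) ℂ) → ℝ} (hS : Measurable S) {s' : ℝ} (hs : ∀ u, |S u| ≤ s') :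
    ∃ χ : Site 4 4 → ZMod 2, (∀ (x : Site 4 4) (i : Fin 4), χ (x.shift i) ≠ χ x) ∧
    ∃ layers : List ((GaugeConfig 4 4 (Matrix.specialUnitaryGroup (Fin 2) ℂ) ≃ᵐ GaugeConfig 4 4 (Matrix.specialUnitaryGroup (Fin 2) ℂ)) × (GaugeConfig 4 4 (Matrix.specialUnitaryGroup (Fin 2) ℂ) → ℝ)),
      layers.map (fun Ly => ((Ly.1 : GaugeConfig 4 4 (Matrix.specialUnitaryGroup (Fin 2) ℂ) → GaugeConfig 4 4 (Matrix.specialUnitaryGroup (Fin 2) ℂ)), Ly.2)) =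
        ((List.replicate nsweeps ((List.finRange 4).flatMap fun μ : Fin 4 => [(μ, (0 : ZMod 2)), (μ, 1)])).flatten).map (fun s =>
        ((fun (V : GaugeConfig 4 4 (Matrix.specialUnitaryGroup (Fin 2) ℂ)) (e : Edge 4 4) =>
        if e.2 = s.1 ∧ χ e.1 = s.2 then
          gaussUnit (geodesicKick ε (∑ ν ∈ Finset.univ.erase e.2,
            (vecQuat (((V (Site.shift e.1 e.2, ν) * (V (Site.shift e.1 ν, e.2))⁻¹ * (V (e.1, ν))⁻¹)⁻¹ : (Matrix.specialUnitaryGroup (Fin 2) ℂ)) : Matrix (Fin 2) (Fin 2) ℂ) +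
              vecQuat ((((V (Site.shift (e.1 - Pi.single ν 1) e.2, ν))⁻¹ * (V (e.1 - Pi.single ν 1, e.2))⁻¹ *
                V (e.1 - Pi.single ν 1, ν))⁻¹ : (Matrix.specialUnitaryGroup (Fin 2) ℂ)) : Matrix (Fin 2) (Fin 2) ℂ)))
            (vecQuat ((V e : (Matrix.specialUnitaryGroup (Fin 2) ℂ)) : Matrix (Fin 2) (Fin 2) ℂ)))
        else V e),
         fun V : GaugeConfig 4 4 (Matrix.specialUnitaryGroup (Fin 2) ℂ) => ∏ a : {e : Edge 4 4 // e.2 = s.1 ∧ χ e.1 = s.2},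
          (if Real.sin (angle (∑ ν ∈ Finset.univ.erase a.1.2,
            (vecQuat (((V (Site.shift a.1.1 a.1.2, ν) * (V (Site.shift a.1.1 ν, a.1.2))⁻¹ * (V (a.1.1, ν))⁻¹)⁻¹ : (Matrix.specialUnitaryGroup (Fin 2) ℂ)) : Matrix (Fin 2) (Fin 2) ℂ) +
              vecQuat ((((V (Site.shift (a.1.1 - Pi.single ν 1) a.1.2, ν))⁻¹ * (V (a.1.1 - Pi.single ν 1, a.1.2))⁻¹ *
                V (a.1.1 - Pi.single ν 1, ν))⁻¹ : (Matrix.specialUnitaryGroup (Fin 2) ℂ)) : Matrix (Fin 2) (Fin 2) ℂ))) (vecQuat ((V a.1 : (Matrix.specialUnitaryGroup (Fin 2) ℂ)) : Matrix (Fin 2) (Fin 2) ℂ))) = 0 then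
            (1 - ε * ‖(∑ ν ∈ Finset.univ.erase a.1.2,
            (vecQuat (((V (Site.shift a.1.1 a.1.2, ν) * (V (Site.shift a.1.1 ν, a.1.2))⁻¹ * (V (a.1.1, ν))⁻¹)⁻¹ : (Matrix.specialUnitaryGroup (Fin 2) ℂ)) : Matrix (Fin 2) (Fin 2) ℂ) +
              vecQuat ((((V (Site.shift (a.1.1 - Pi.single ν 1) a.1.2, ν))⁻¹ * (V (a.1.1 - Pi.single ν 1, a.1.2))⁻¹ *
                V (a.1.1 - Pi.single ν 1, ν))⁻¹ : (Matrix.specialUnitaryGroup (Fin 2) ℂ)) : Matrix (Fin 2) (Fin 2) ℂ)))‖ * Real.cos (angle (∑ ν ∈ Finset.univ.erase a.1.2,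
            (vecQuat (((V (Site.shift a.1.1 a.1.2, ν) * (V (Site.shift a.1.1 ν, a.1.2))⁻¹ * (V (a.1.1, ν))⁻¹)⁻¹ : (Matrix.specialUnitaryGroup (Fin 2) ℂ)) : Matrix (Fin 2) (Fin 2) ℂ) +
              vecQuat ((((V (Site.shift (a.1.1 - Pi.single ν 1) a.1.2, ν))⁻¹ * (V (a.1.1 - Pi.single ν 1, a.1.2))⁻¹ *
                V (a.1.1 - Pi.single ν 1, ν))⁻¹ : (Matrix.specialUnitaryGroup (Fin 2) ℂ)) : Matrix (Fin 2) (Fin 2) ℂ))) (vecQuat ((V a.1 : (Matrix.specialUnitaryGroup (Fin 2) ℂ)) : Matrix (Fin 2) (Fin 2) ℂ)))) ^ 3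
          else kickJac (ε * ‖(∑ ν ∈ Finset.univ.erase a.1.2,
            (vecQuat (((V (Site.shift a.1.1 a.1.2, ν) * (V (Site.shift a.1.1 ν, a.1.2))⁻¹ * (V (a.1.1, ν))⁻¹)⁻¹ : (Matrix.specialUnitaryGroup (Fin 2) ℂ)) : Matrix (Fin 2) (Fin 2) ℂ) +
              vecQuat ((((V (Site.shift (a.1.1 - Pi.single ν 1) a.1.2, ν))⁻¹ * (V (a.1.1 - Pi.single ν 1, a.1.2))⁻¹ *
                V (a.1.1 - Pi.single ν 1, ν))⁻¹ : (Matrix.specialUnitaryGroup (Fin 2) ℂ)) : Matrix (Fin 2) (Fin 2) ℂ)))‖) 2 (angle (∑ ν ∈ Finset.univ.erase a.1.2,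
            (vecQuat (((V (Site.shift a.1.1 a.1.2, ν) * (V (Site.shift a.1.1 ν, a.1.2))⁻¹ * (V (a.1.1, ν))⁻¹)⁻¹ : (Matrix.specialUnitaryGroup (Fin 2) ℂ)) : Matrix (Fin 2) (Fin 2) ℂ) +
              vecQuat ((((V (Site.shift (a.1.1 - Pi.single ν 1) a.1.2, ν))⁻¹ * (V (a.1.1 - Pi.single ν 1, a.1.2))⁻¹ *
                V (a.1.1 - Pi.single ν 1, ν))⁻¹ : (Matrix.specialUnitaryGroup (Fin 2) ℂ)) : Matrix (Fin 2) (Fin 2) ℂ))) (vecQuat ((V a.1 : (Matrix.specialUnitaryGroup (Fin 2) ℂ)) : Matrix (Fin 2) (Fin 2) ℂ)))))) ∧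
      layers.length = 8 * nsweeps ∧
      ∃ δ : ℝ, 0 < δ ∧ δ ≤ 1 ∧ ∀ (μ₀ : Measure (GaugeConfig 4 4 (Matrix.specialUnitaryGroup (Fin 2) ℂ))) [IsProbabilityMeasure μ₀] (t : ℕ) (A : Set (GaugeConfig 4 4 (Matrix.specialUnitaryGroup (Fin 2) ℂ))),
        |((fun m : Measure (GaugeConfig 4 4 (Matrix.specialUnitaryGroup (Fin 2) ℂ)) =>
              m.bind (conjKernel (su2LeapfrogHMC ε' κ' hg fun V => S ((layers.foldr (fun Ly (G : GaugeConfig 4 4 (Matrix.specialUnitaryGroup (Fin 2) ℂ) ≃ᵐ GaugeConfig 4 4 (Matrix.specialUnitaryGroup (Fin 2) ℂ)) => Ly.1.trans G)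
              (MeasurableEquiv.refl (GaugeConfig 4 4 (Matrix.specialUnitaryGroup (Fin 2) ℂ)))) V) -
                Real.log ((layers.foldr (fun Ly K => fun V => Ly.2 V * K (Ly.1 V)) (fun _ => (1 : ℝ))) V)) (layers.foldr (fun Ly (G : GaugeConfig 4 4 (Matrix.specialUnitaryGroup (Fin 2) ℂ) ≃ᵐ GaugeConfig 4 4 (Matrix.specialUnitaryGroup (Fin 2) ℂ)) => Ly.1.trans G)
              (MeasurableEquiv.refl (GaugeConfig 4 4 (Matrix.specialUnitaryGroup (Fin 2) ℂ))))))^[t] μ₀).real A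
            - (su2GibbsLaw S).real A| ≤ (1 - δ) ^ t := by
  obtain ⟨χ, hχ⟩ := exists_parityMask (d := 4) (L := 4) (by decide)
  have hε6 : |ε| * (2 * ((4 - 1 : ℕ) : ℝ)) < 1 := by norm_num; linarith
  obtain ⟨layers, hmap, hδ⟩ := su2WilsonFlowLO_member_fthmc_uniformlyErgodic χ hχ hε6
    ((List.replicate nsweeps ((List.finRange 4).flatMap fun μ : Fin 4 => [(μ, (0 : ZMod 2)), (μ, 1)])).flatten) hε' hκ' hg hb0 hb hS hs
  refine ⟨χ, hχ, layers, hmap, ?_, hδ⟩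
  have h := congrArg List.length hmap
  rw [List.length_map, List.length_map, length_luscherSchedule_four] at h
  exact h

end Summit.Ventures.LatticeQCDFlow.Exactness
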